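import Mathlib.RingTheory.Ideal.Cotangent
import Mathlib.RingTheory.LocalRing.RingHom.Basic
import Literature.AlgebraicGeometry.GroupSchemes.AffineGroupSchemeHopfAlgebra   -- ★ `AffineGroupScheme.Alg`
import HarnessLib

/-!
# The unit point of a `k`-group scheme: the augmentation ideal `I_e ⊆ Γ(X, 𝒪_X)`, its maximality, and the stalk `𝒪_{X,e}` as its localisation

Topic `Literature/AlgebraicGeometry/GroupSchemes`; namespace `Literature.AlgebraicGeometry.GroupSchemes`.  THEOREMS ONLY, in the
explicit currency `e = η(pt)`, `I_e = (RingHom.ker Γ(η_X) : Ideal (Alg X))` of the unit cotangent space `I_e ∕ I_e²` used by ★ `BarsottiTateGroupConnectedPartTangent`,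
★ `BarsottiTateGroupFixedPartCotangent` and the P6b kit's `htan`∕`hdim`; no definition, no named fact, no instance, no notation, no `sorry`.  Cell `hodgecm-mathlib` (D-0151), P6 «MOD programme», K∕BT cut v2 DEAL 2 (F0P6d-plan (g2) → B-p12 (g32)): the
generic half of «THE COTANGENT SPACE OF A KERNEL» (sequel: `Motives/AbelianVarietyKernelCotangent`, `Motives/AbelianVarietyTorsionCotangent`).
HC_CM is proved only modulo the printed citations until rung 0 closes; nothing here is about HC.

THE PRINT.  [GortzWedhorn2020] (6.4) Definition 6.2: the Zariski cotangent space `𝔪_x ∕ 𝔪_x²` of a point; §6.3 (6.3.1)–Remark 6.4: for an affine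
`X = Spec A` and a closed point `x` with maximal ideal `𝔪 ⊆ A`, `𝔪_x ∕ 𝔪_x² = 𝔪 ∕ 𝔪²` because `𝒪_{X,x} = A_𝔪`; Definition 4.45 (1): group schemes and
their unit section.  Here `x = e` is the unit of a `k`-group scheme `X` and `𝔪 = I_e = ker (Γ(η) : Γ(X, 𝒪_X) → Γ(Spec k) = k)`.

WHAT IS HERE (`k` a field, `X : Over (Spec k)` with `[GrpObj X]`):
* §A `Ideal.mapCotangent_bijective_of_surjective_of_ker_le_sq` — a SURJECTIVE algebra map `φ : S ↠ S'` with `ker φ ⊆ I²`, `I = φ⁻¹ J`, induces a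
  bijection `I ∕ I² ⥲ J ∕ J²` (pure commutative algebra; companion of ★ `Ideal.mapCotangent_comap_bijective_of_surjective_of_isIdempotentElem_ker`).
* §B `(((η[X] : 𝟙_ (Over (Spec (.of k))) ⟶ X).left).base (IsLocalRing.closedPoint k))`, `(RingHom.ker ((η[X] : 𝟙_ (Over (Spec (.of k))) ⟶ X).left.appTop.hom) : Ideal (Alg X))`; `mem_unitAugIdeal_iff_germ_mem` (`s ∈ I_e ↔ s_e ∈ 𝔪_e`); `ΓSpecIso_unit_appTop_algebraMap` (the augmentation
  splits the structure map); **`unitAugIdeal_isMaximal`**; **`isLocalization_stalk_unitAugIdeal`** (for AFFINE `X`: `𝒪_{X,e}` is the localisation of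
  `Γ(X, 𝒪_X)` at `I_e`, Mathlib `IsAffineOpen.isLocalization_stalk` with the prime of `e` identified with `I_e`) — so ★
  `RingTheory/Localization/CotangentAtMaximalIdeal.cotangentLocalizationEquiv` gives `I_e ∕ I_e² ≅ 𝔪_e ∕ 𝔪_e²`.

## References
* [GortzWedhorn2020] U. Görtz, T. Wedhorn, *Algebraic Geometry I* (2nd ed., 2020) — Definition 4.45 (p. 117); (6.4) Definition 6.2; §6.3 (6.3.1), Remark 6.4.
-/

set_option autoImplicit false

noncomputable section

universe u

open CategoryTheory CategoryTheory.Limits AlgebraicGeometry MonoidalCategory CartesianMonoidalCategory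
open IsLocalRing
open scoped MonObj

namespace Literature.AlgebraicGeometry.GroupSchemes

/-! ## §A Commutative algebra: a surjection whose kernel lies in `I²` induces a bijection `I∕I² ⥲ J∕J²` (`J = φ⁻¹`-saturated) -/

section Algebra

variable {R : Type*} {S : Type*} {S' : Type*} [CommRing R] [CommRing S] [CommRing S'] [Algebra R S] [Algebra R S']

/-- **A surjective algebra map `φ : S ↠ S'` whose kernel lies in `I²` induces a BIJECTION `I∕I² ⥲ J∕J²` for `I = φ⁻¹ J`**
(Mathlib `Ideal.mapCotangent`): surjective because `φ(I) = J`; injective because `φ a ∈ J² = φ(I²)` gives `a ∈ I² + ker φ ⊆ I²`.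
[cite: GortzWedhorn2020, (6.4) Definition 6.2] -/
theorem Ideal.mapCotangent_bijective_of_surjective_of_ker_le_sq (φ : S →ₐ[R] S') (hφ : Function.Surjective φ)
    (J : Ideal S') (I : Ideal S) (hIJ : J.comap φ = I) (hK : RingHom.ker φ.toRingHom ≤ I ^ 2) :
    Function.Bijective (Ideal.mapCotangent I J φ hIJ.ge) := by
  subst hIJ
  constructor
  · rw [injective_iff_map_eq_zero]
    intro x hx
    obtain ⟨⟨a, ha⟩, rfl⟩ := (J.comap φ).toCotangent_surjective x
    rw [Ideal.mapCotangent_toCotangent] at hx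
    replace hx := (Ideal.toCotangent_eq_zero _ _).mp hx
    refine (Ideal.toCotangent_eq_zero _ _).mpr ?_
    have hJ : J = Ideal.map φ (J.comap φ) := (Ideal.map_comap_of_surjective φ hφ J).symm
    have hx' : φ a ∈ Ideal.map φ ((J.comap φ) ^ 2) := by rw [Ideal.map_pow, ← hJ]; exact hx
    obtain ⟨a', ha', haa'⟩ := (Ideal.mem_map_iff_of_surjective φ hφ).mp hx'
    have hdiff : a - a' ∈ RingHom.ker φ.toRingHom := by
      rw [RingHom.mem_ker]
      change φ (a - a') = 0
      rw [map_sub, haa', sub_self]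
    have hsum : a = a' + (a - a') := by ring
    change a ∈ (J.comap φ) ^ 2
    rw [hsum]
    exact Ideal.add_mem _ ha' (hK hdiff)
  · intro y
    obtain ⟨⟨b, hb⟩, rfl⟩ := J.toCotangent_surjective y
    obtain ⟨a, rfl⟩ := hφ b
    exact ⟨(J.comap φ).toCotangent ⟨a, hb⟩, by rw [Ideal.mapCotangent_toCotangent]⟩

end Algebra

/-! ## §B The unit point of a `k`-group scheme: augmentation ideal, its maximality, and the stalk as its localisation -/

section UnitStalk

open Literature.AlgebraicGeometry.GroupSchemes.AffineGroupScheme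

variable {k : Type u} [Field k] (X : Over (Spec (.of k))) [GrpObj X]

omit [GrpObj X] in
/-- Non-zero global sections of `Spec k` are units (`Γ(Spec k) ≅ k`). [folklore] -/
private theorem isUnit_ΓSpec_of_ne_zero {x : Γ(Spec (CommRingCat.of k), ⊤)} (hx : x ≠ 0) : IsUnit x := by
  have h1 : (Scheme.ΓSpecIso (.of k)).hom x ≠ 0 := fun h0 => hx (by
    have := congrArg (Scheme.ΓSpecIso (.of k)).inv h0
    rwa [← CommRingCat.comp_apply, Iso.hom_inv_id, CommRingCat.id_apply, map_zero] at this)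
  have h2 := (isUnit_iff_ne_zero.mpr h1).map (Scheme.ΓSpecIso (.of k)).inv.hom
  rwa [← CommRingCat.comp_apply, Iso.hom_inv_id, CommRingCat.id_apply] at h2

/-- **`s ∈ I_e ↔ s_e ∈ 𝔪_e`**: a global section vanishes at the unit iff its germ at the unit point is not a unit (the stalk map of
`η : Spec k → X` at the closed point is local, and the stalk of `Spec k` is a field). [cite: GortzWedhorn2020, (6.4) Definition 6.2] -/
theorem mem_unitAugIdeal_iff_germ_mem (s : Alg X) :
    s ∈ (RingHom.ker ((η[X] : 𝟙_ (Over (Spec (.of k))) ⟶ X).left.appTop.hom) : Ideal (Alg X)) ↔ X.left.presheaf.germ ⊤ ((((η[X] : 𝟙_ (Over (Spec (.of k))) ⟶ X).left).base (IsLocalRing.closedPoint k))) _root_.trivial s ∈ maximalIdeal (X.left.presheaf.stalk ((((η[X] : 𝟙_ (Over (Spec (.of k))) ⟶ X).left).base (IsLocalRing.closedPoint k)))) := by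
  set ηl : (Spec (.of k) : Scheme.{u}) ⟶ X.left := (η[X] : 𝟙_ (Over (Spec (.of k))) ⟶ X).left with hηl
  have hgerm : (ηl.stalkMap (IsLocalRing.closedPoint k)) (X.left.presheaf.germ ⊤ ((((η[X] : 𝟙_ (Over (Spec (.of k))) ⟶ X).left).base (IsLocalRing.closedPoint k))) _root_.trivial s) =
      (Spec (.of k)).presheaf.germ ⊤ (IsLocalRing.closedPoint k) _root_.trivial (ηl.appTop s) :=
    Scheme.Hom.germ_stalkMap_apply ηl ⊤ (IsLocalRing.closedPoint k) _root_.trivial s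
  constructor
  · intro hs
    rw [RingHom.mem_ker] at hs
    rw [mem_maximalIdeal, mem_nonunits_iff]
    intro hu
    have h1 := hu.map (ηl.stalkMap (IsLocalRing.closedPoint k)).hom
    rw [hgerm, show ηl.appTop s = 0 from hs, map_zero] at h1
    exact not_isUnit_zero h1
  · intro hm
    rw [RingHom.mem_ker]
    by_contra hs
    have h2 : IsUnit ((ηl.stalkMap (IsLocalRing.closedPoint k)) (X.left.presheaf.germ ⊤ ((((η[X] : 𝟙_ (Over (Spec (.of k))) ⟶ X).left).base (IsLocalRing.closedPoint k))) _root_.trivial s)) := by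
      rw [hgerm]
      exact (isUnit_ΓSpec_of_ne_zero hs).map _
    exact (mem_maximalIdeal _).mp hm ((isUnit_map_iff (ηl.stalkMap _).hom _).mp h2)

/-- The augmentation `ε : Γ(X, 𝒪_X) → k` of the unit (the unit section read through `Γ(Spec k) ≅ k`) splits the structure map.
[cite: GortzWedhorn2020, (6.4) Definition 6.2] -/
theorem ΓSpecIso_unit_appTop_algebraMap (c : k) :
    (Scheme.ΓSpecIso (.of k)).hom ((η[X] : 𝟙_ (Over (Spec (.of k))) ⟶ X).left.appTop (algebraMap k (Alg X) c)) = c := by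
  set ηl : (Spec (.of k) : Scheme.{u}) ⟶ X.left := ((η[X] : 𝟙_ (Over (Spec (.of k))) ⟶ X).left) with hηl
  have hsec : ηl ≫ X.hom = 𝟙 _ := Over.w _
  have hring : ((Scheme.ΓSpecIso (.of k)).inv ≫ X.hom.appTop) ≫ (ηl.appTop ≫ (Scheme.ΓSpecIso (.of k)).hom) = 𝟙 _ := by
    rw [Category.assoc, ← Category.assoc X.hom.appTop, ← Scheme.Hom.comp_appTop, hsec, Scheme.Hom.id_appTop,
      Category.id_comp, Iso.inv_hom_id]
  have h := congrArg (fun φ => φ.hom c) hring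
  simp only [CommRingCat.hom_comp, RingHom.coe_comp, Function.comp_apply, CommRingCat.hom_id, RingHom.id_apply] at h
  exact h

/-- **The augmentation ideal of the unit is maximal** (it is the kernel of the surjection `Γ(X, 𝒪_X) → Γ(Spec k) ≅ k`).
[cite: GortzWedhorn2020, (6.4) Definition 6.2] -/
theorem unitAugIdeal_isMaximal : ((RingHom.ker ((η[X] : 𝟙_ (Over (Spec (.of k))) ⟶ X).left.appTop.hom) : Ideal (Alg X))).IsMaximal := by
  let ε : Alg X →+* k := (Scheme.ΓSpecIso (.of k)).hom.hom.comp ((η[X] : 𝟙_ (Over (Spec (.of k))) ⟶ X).left.appTop.hom)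
  have hsurj : Function.Surjective ε := fun c => ⟨algebraMap k (Alg X) c, ΓSpecIso_unit_appTop_algebraMap X c⟩
  have hker : RingHom.ker ε = (RingHom.ker ((η[X] : 𝟙_ (Over (Spec (.of k))) ⟶ X).left.appTop.hom) : Ideal (Alg X)) :=
    RingHom.ker_comp_of_injective _ (Scheme.ΓSpecIso (.of k)).commRingCatIsoToRingEquiv.injective
  rw [← hker]
  exact RingHom.ker_isMaximal_of_surjective ε hsurj

/-- **The stalk at the unit point of an AFFINE `k`-group scheme is the localisation of `Γ(X, 𝒪_X)` at `I_e`** (Mathlib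
`IsAffineOpen.isLocalization_stalk`, with the prime of the unit point identified with `I_e`). [cite: GortzWedhorn2020, §6.3 (6.3.1) and Remark 6.4] -/
theorem isLocalization_stalk_unitAugIdeal [IsAffine X.left] :
    letI : Algebra (Alg X) (X.left.presheaf.stalk ((((η[X] : 𝟙_ (Over (Spec (.of k))) ⟶ X).left).base (IsLocalRing.closedPoint k)))) :=
      ((X.left.presheaf.germ ⊤ ((((η[X] : 𝟙_ (Over (Spec (.of k))) ⟶ X).left).base (IsLocalRing.closedPoint k))) _root_.trivial).hom : Alg X →+* _).toAlgebra
    haveI := (unitAugIdeal_isMaximal X).isPrime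
    IsLocalization.AtPrime (X.left.presheaf.stalk ((((η[X] : 𝟙_ (Over (Spec (.of k))) ⟶ X).left).base (IsLocalRing.closedPoint k)))) ((RingHom.ker ((η[X] : 𝟙_ (Over (Spec (.of k))) ⟶ X).left.appTop.hom) : Ideal (Alg X))) := by
  letI : Algebra (Alg X) (X.left.presheaf.stalk ((((η[X] : 𝟙_ (Over (Spec (.of k))) ⟶ X).left).base (IsLocalRing.closedPoint k)))) :=
    ((X.left.presheaf.germ ⊤ ((((η[X] : 𝟙_ (Over (Spec (.of k))) ⟶ X).left).base (IsLocalRing.closedPoint k))) _root_.trivial).hom : Alg X →+* _).toAlgebra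
  haveI := (unitAugIdeal_isMaximal X).isPrime
  have h := (isAffineOpen_top X.left).isLocalization_stalk ⟨(((η[X] : 𝟙_ (Over (Spec (.of k))) ⟶ X).left).base (IsLocalRing.closedPoint k)), _root_.trivial⟩
  have hP : ((isAffineOpen_top X.left).primeIdealOf ⟨(((η[X] : 𝟙_ (Over (Spec (.of k))) ⟶ X).left).base (IsLocalRing.closedPoint k)), _root_.trivial⟩).asIdeal = (RingHom.ker ((η[X] : 𝟙_ (Over (Spec (.of k))) ⟶ X).left.appTop.hom) : Ideal (Alg X)) := by
    ext s
    rw [IsAffineOpen.primeIdealOf_eq_map_closedPoint, Spec.map_apply, PrimeSpectrum.comap_asIdeal, Ideal.mem_comap]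
    exact (mem_unitAugIdeal_iff_germ_mem X s).symm
  have hM : ((RingHom.ker ((η[X] : 𝟙_ (Over (Spec (.of k))) ⟶ X).left.appTop.hom) : Ideal (Alg X))).primeCompl =
      ((isAffineOpen_top X.left).primeIdealOf ⟨(((η[X] : 𝟙_ (Over (Spec (.of k))) ⟶ X).left).base (IsLocalRing.closedPoint k)), _root_.trivial⟩).asIdeal.primeCompl := by
    ext s
    change s ∉ (RingHom.ker ((η[X] : 𝟙_ (Over (Spec (.of k))) ⟶ X).left.appTop.hom) : Ideal (Alg X)) ↔ s ∉ ((isAffineOpen_top X.left).primeIdealOf ⟨(((η[X] : 𝟙_ (Over (Spec (.of k))) ⟶ X).left).base (IsLocalRing.closedPoint k)), _root_.trivial⟩).asIdeal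
    rw [hP]
    exact Iff.rfl
  change IsLocalization ((RingHom.ker ((η[X] : 𝟙_ (Over (Spec (.of k))) ⟶ X).left.appTop.hom) : Ideal (Alg X))).primeCompl _
  rw [hM]
  exact h

end UnitStalk

end Literature.AlgebraicGeometry.GroupSchemes

end
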